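import Mathlib
import Summits.NavierStokesRegularity.FluidComputer.AbcLatticeEigenSynthesis
import Summits.NavierStokesRegularity.FluidComputer.SkewCutCertificate
import HarnessLib

/-!
# The pairing of the ABC lattice linearisation: transport + stretch split, skewness of the
# transport part, and the pointwise strain bound (ASSEMBLY obligation (A4), pairing half, of
# `HOME/instab4/KERNEL-CHAIN.md`, part 1 of 2; instab4 g5 — implementation 2 of the X0 chain,
# cell `ns-blowup`, 2026-08-26)

HONEST FRAMING (human ruling D-0035): nothing here is a claim about Navier–Stokes blow-up.
WHAT THIS IS NOT: not NS evidence; MODEL lane (linearisation of forced Navier–Stokes about the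
exact steady ABC state). No certificate is moved by this file. Both X0 certifiers (instab3 `i3cert`,
instab4 `cert.py`) and the selfsim/cap certificates take as an ANALYTIC INPUT the constant
`s = √2` bounding the symmetric part of the first-order part of the operator
`L_R c(k) = −(1/R)|k|² c(k) + P_k Σ_s Û(s) × (i(k−s) × c(k−s) − c(k−s))` (cert.py `SQRT2`,
`test_lemma_S`; SKEWCUT-CERT §3 (F1)–(F2) + Lemma S): for transversal `c`,
`|Re Σ_k ⟪c(k), Σ_{s∈{±e_j}} Û(s) × (i(k−s) × c(k−s) − c(k−s))⟫| ≤ √2 Σ_k ‖c(k)‖²`.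
So far this was prose (pointwise Lemma S `SkewCutCertificate.abc_strain_form_abs_le` is kernel;
the passage operator ↦ pointwise strain was not). This file and its sequel
`AbcLatticePairingBound` prove it for every finitely supported transversal Cartesian family
`c : ℤ³ → ℂ³` — i.e. for EVERY Galerkin section of the operator, in particular for the class-II
cube sections the certificates use. This part:

* §1 `inner_crossForm_eq` — per frequency, for transversal `c(k)`:
  `⟪c(k), X(k)⟫ = −(1/2π)·Σ_s Σ_p Σ_j conj c_p(k) (Û_j(s)(2πi (k−s)_j) c_p(k−s) + c_j(k−s)(2πi s_j) Û_p(s))`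
  — TRANSPORT pairing plus STRETCH pairing (symbol-level polarised Lamb identity
  `AbcLatticeEigenSynthesis.lamb_pair_symbol` + Beltrami shell relation; any `A, B, C`).
* §2 `re_transportPairing_eq_zero` — (F1): the real part of the summed transport pairing vanishes for
  finitely supported `c` (the involution `(k, s) ↦ (k − s, −s)`, reality `Û(−s) = conj Û(s)` and
  transversality `Û(s)·s = 0` of the background; any `A, B, C`).
* §3 `jacobian_entry` — the lattice symbol `Σ_s e_s(x) (2πi s_j) Û_p(s)` of `U = abcFlow 1 1 1` IS
  `2π×` the Jacobian of `(sin z + cos y, sin x + cos z, sin y + cos x)` at `2πx`;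
  `abs_re_jacobianForm_le` / `abs_re_jacobianForm_le'` — pointwise Lemma S for COMPLEX vectors:
  `|Re v̄ᵀ(2πD(x))v| ≤ 2π√2‖v‖²` (real and imaginary parts separately obey
  `SkewCutCertificate.strain_form_sq_le`).

Mathlib + the files named; no new definitions, no named facts.
-/

noncomputable section

open scoped BigOperators ComplexConjugate Matrix
open Filter Set Function MeasureTheory UnitAddTorus

namespace Summit.NavierStokesRegularity.FluidComputer.AbcLatticePairingSplit

open Literature.Analysis.FunctionSpaces Literature.Analysis.FunctionSpaces.Torus
open Literature.Analysis.FunctionSpaces.EuclideanSpace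
open Literature.Analysis.FluidPDE Literature.Analysis.FluidPDE.ScalarFourier
open Literature.Analysis.FluidPDE.SteadyLattice
open AbcLatticeEigenSynthesis

/-! ## §1 The pairing per frequency: transport + stretch -/

/-- The `ℂ³` inner product in coordinates: `⟪x, y⟫ = Σ_p conj(x_p) y_p`. [folklore] -/
theorem inner_fin3_eq_sum (x y : EuclideanSpace ℂ (Fin 3)) :
    (inner ℂ x y : ℂ) = ∑ p : Fin 3, conj (x p) * y p := by
  rw [PiLp.inner_apply]
  refine Finset.sum_congr rfl fun p _ => ?_
  rw [RCLike.inner_apply']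

/-- **The pairing per frequency.** For `c(k)` transversal (`k·c(k) = 0`):
`⟪c(k), Σ_s Û(s) × (i(k−s) × c(k−s) − c(k−s))⟫ =
 −(1/2π) Σ_s Σ_p Σ_j conj c_p(k) · (Û_j(s) (2πi (k−s)_j) c_p(k−s) + c_j(k−s) (2πi s_j) Û_p(s))`
(first summand: TRANSPORT pairing; second: STRETCH pairing). Any `A, B, C`. -/
theorem inner_crossForm_eq (A B C : ℝ) (c : (Fin 3 → ℤ) → EuclideanSpace ℂ (Fin 3)) (k : Fin 3 → ℤ)
    (hck : (∑ jj : Fin 3, ((k jj : ℤ) : ℂ) * (c k) jj) = 0) :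
    (inner ℂ (c k) (∑ s ∈ Torus.abcFreq, (WithLp.toLp 2 (crossProduct (WithLp.ofLp (Torus.abcCoeff A B C s))
          (Complex.I • crossProduct (fun j => (((k - s) j : ℤ) : ℂ)) (WithLp.ofLp (c (k - s))) -
            WithLp.ofLp (c (k - s)))) : EuclideanSpace ℂ (Fin 3))) : ℂ) =
      -(1 / (2 * Real.pi)) * ∑ s ∈ Torus.abcFreq, ∑ pp : Fin 3, ∑ j : Fin 3,
        conj (c k pp) * (Torus.abcCoeff A B C s j * (2 * Real.pi * Complex.I * (((k - s) j : ℤ) : ℂ)) * c (k - s) pp +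
          c (k - s) j * (2 * Real.pi * Complex.I * ((s j : ℤ) : ℂ)) * Torus.abcCoeff A B C s pp) := by
  set a := Torus.abcCoeff A B C with ha
  have hπ : (2 * Real.pi : ℂ) ≠ 0 := by
    have : (Real.pi : ℂ) ≠ 0 := by exact_mod_cast Real.pi_ne_zero
    exact mul_ne_zero two_ne_zero this
  -- the polarised Lamb identity, solved for the cross-product form
  have hX : ∀ s ∈ Torus.abcFreq, ∀ pp : Fin 3,
      crossProduct (WithLp.ofLp (a s))
          (Complex.I • crossProduct (fun j => (((k - s) j : ℤ) : ℂ)) (WithLp.ofLp (c (k - s))) -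
            WithLp.ofLp (c (k - s))) pp =
        (1 / (2 * Real.pi)) * (2 * Real.pi * Complex.I *
            (∑ j : Fin 3, WithLp.ofLp (a s) j * WithLp.ofLp (c (k - s)) j) * ((k pp : ℤ) : ℂ) -
          ∑ j : Fin 3, (WithLp.ofLp (a s) j * (2 * Real.pi * Complex.I * (((k - s) j : ℤ) : ℂ)) *
              WithLp.ofLp (c (k - s)) pp +
            WithLp.ofLp (c (k - s)) j * (2 * Real.pi * Complex.I * ((s j : ℤ) : ℂ)) * WithLp.ofLp (a s) pp)) := by
    intro s hs pp
    obtain ⟨y, hy⟩ := Torus.mem_abcFreq.mp hs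
    have hB := crossProduct_abcDir_abcCoeff A B C y
    rw [hy, ← ha] at hB
    have hL := lamb_pair_symbol (WithLp.ofLp (a s)) (WithLp.ofLp (c (k - s))) (fun j => ((s j : ℤ) : ℂ))
      (fun j => (((k - s) j : ℤ) : ℂ)) pp
    beta_reduce at hL
    rw [hB, LinearMap.map_zero, Pi.zero_apply, mul_zero, sub_zero] at hL
    have hks : ((s pp : ℤ) : ℂ) + (((k - s) pp : ℤ) : ℂ) = ((k pp : ℤ) : ℂ) := by
      rw [Pi.sub_apply]; push_cast; ring
    rw [hks] at hL
    rw [hL]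
    field_simp
    ring
  -- conj (k · c(k)) = 0
  have hck' : ∑ pp : Fin 3, conj (WithLp.ofLp (c k) pp) * ((k pp : ℤ) : ℂ) = 0 := by
    have h := congrArg conj hck
    rw [map_sum, map_zero] at h
    rw [← h]
    refine Finset.sum_congr rfl fun pp _ => ?_
    rw [map_mul, map_intCast, mul_comm]
  -- expand the inner product
  rw [inner_fin3_eq_sum, WithLp.ofLp_sum]
  simp only [Finset.sum_apply, Finset.mul_sum]
  rw [Finset.sum_comm]
  refine Finset.sum_congr rfl fun s hs => ?_
  have step : ∀ pp : Fin 3, conj (WithLp.ofLp (c k) pp) * crossProduct (WithLp.ofLp (a s))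
      (Complex.I • crossProduct (fun j => (((k - s) j : ℤ) : ℂ)) (WithLp.ofLp (c (k - s))) -
        WithLp.ofLp (c (k - s))) pp =
      ((1 / (2 * Real.pi)) * (2 * Real.pi * Complex.I *
          (∑ j : Fin 3, WithLp.ofLp (a s) j * WithLp.ofLp (c (k - s)) j))) *
          (conj (WithLp.ofLp (c k) pp) * ((k pp : ℤ) : ℂ)) -
        (1 / (2 * Real.pi)) * (conj (WithLp.ofLp (c k) pp) *
          ∑ j : Fin 3, (WithLp.ofLp (a s) j * (2 * Real.pi * Complex.I * (((k - s) j : ℤ) : ℂ)) *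
              WithLp.ofLp (c (k - s)) pp +
            WithLp.ofLp (c (k - s)) j * (2 * Real.pi * Complex.I * ((s j : ℤ) : ℂ)) * WithLp.ofLp (a s) pp)) := by
    intro pp
    rw [hX s hs pp]
    ring
  rw [Finset.sum_congr rfl fun pp _ => step pp, Finset.sum_sub_distrib, ← Finset.mul_sum, ← Finset.mul_sum,
    hck', mul_zero, zero_sub, Finset.mul_sum, ← Finset.sum_neg_distrib]
  refine Finset.sum_congr rfl fun pp _ => ?_
  rw [Finset.mul_sum, Finset.mul_sum, ← Finset.sum_neg_distrib]
  refine Finset.sum_congr rfl fun j _ => ?_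
  ring

/-! ## §2 (F1) The transport pairing has vanishing real part -/

/-- **(F1) The transport part is skew.** For a finitely supported `c` (support in `F`) and the ABC
coefficients `Û = Torus.abcCoeff A B C` (real flow: `Û(−s) = conj Û(s)`; divergence free:
`Û(s)·s = 0` on the shell):
`Re Σ_{k∈F} Σ_{s} Σ_p Σ_j conj c_p(k) · Û_j(s) (2πi (k−s)_j) c_p(k−s) = 0` — the lattice form of
`Re ∫ ⟪w, (U·∇)w⟫ = 0` (the pairs `(k, s)` and `(k − s, −s)` are complex-conjugate-skew). -/
theorem re_transportPairing_eq_zero (A B C : ℝ) (c : (Fin 3 → ℤ) → EuclideanSpace ℂ (Fin 3))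
    (F : Finset (Fin 3 → ℤ)) (hcF : ∀ k ∉ F, c k = 0) :
    (∑ k ∈ F, ∑ s ∈ Torus.abcFreq, ∑ pp : Fin 3, ∑ j : Fin 3,
      conj (c k pp) * (Torus.abcCoeff A B C s j * (2 * Real.pi * Complex.I * (((k - s) j : ℤ) : ℂ)) *
        c (k - s) pp)).re = 0 := by
  classical
  set a := Torus.abcCoeff A B C with ha
  -- the summand as a function of the pair `(k, s)`
  set t : (Fin 3 → ℤ) × (Fin 3 → ℤ) → ℂ := fun q => ∑ pp : Fin 3, ∑ j : Fin 3,
    conj (c q.1 pp) * (a q.2 j * (2 * Real.pi * Complex.I * (((q.1 - q.2) j : ℤ) : ℂ)) * c (q.1 - q.2) pp) with ht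
  -- restrict to the pairs with `k - s ∈ F` (the others vanish)
  set E := (F ×ˢ Torus.abcFreq).filter (fun q => q.1 - q.2 ∈ F) with hE
  have hsumE : ∑ k ∈ F, ∑ s ∈ Torus.abcFreq, ∑ pp : Fin 3, ∑ j : Fin 3,
      conj (c k pp) * (a s j * (2 * Real.pi * Complex.I * (((k - s) j : ℤ) : ℂ)) * c (k - s) pp) =
      ∑ q ∈ E, t q := by
    rw [← Finset.sum_product (s := F) (t := Torus.abcFreq) (f := fun q => t q), hE, Finset.sum_filter]
    refine Finset.sum_congr rfl fun q hq => ?_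
    split_ifs with h
    · rfl
    · rw [ht]
      simp only
      refine Finset.sum_eq_zero fun pp _ => Finset.sum_eq_zero fun j _ => ?_
      rw [hcF _ h]
      simp
  rw [hsumE, Complex.re_sum]
  -- the involution `(k, s) ↦ (k - s, -s)` on `E`
  refine Finset.sum_involution (fun q _ => (q.1 - q.2, -q.2)) ?_ ?_ ?_ ?_
  · -- `Re t q + Re t (g q) = 0`
    intro q hq
    obtain ⟨k, s⟩ := q
    simp only [hE, Finset.mem_filter, Finset.mem_product] at hq
    obtain ⟨⟨hkF, hs⟩, hksF⟩ := hq
    -- reality and transversality of the background coefficient at `s`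
    have hreal : ∀ j, a (-s) j = conj (a s j) := fun j => by
      have h := Torus.isConjSymm_abcCoeff A B C s
      rw [← ha] at h
      rw [h, EuclideanSpace.conjVec_apply]
    have htrans : ∑ j : Fin 3, ((s j : ℤ) : ℂ) * a s j = 0 := by
      have h := Torus.isTransversal_abcCoeff A B C s hs
      rw [← ha] at h
      exact h
    have htrans' : ∑ j : Fin 3, conj (a s j) * ((s j : ℤ) : ℂ) = 0 := by
      have h := congrArg conj htrans
      rw [map_sum, map_zero] at h
      rw [← h]
      refine Finset.sum_congr rfl fun j _ => ?_
      rw [map_mul, map_intCast, mul_comm]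
    -- the two summands
    simp only [ht, sub_neg_eq_add, sub_add_cancel]
    rw [← Complex.add_re]
    -- `t (k-s,-s) = -conj (t (k,s)) + 2πi · (Σ_p conj c_p(k-s) c_p(k)) · (Σ_j conj Û_j(s) s_j)`
    have hS' : (∑ pp : Fin 3, ∑ j : Fin 3, conj (c (k - s) pp) * (a (-s) j * (2 * Real.pi * Complex.I *
          ((k j : ℤ) : ℂ)) * c k pp)) =
        -conj (∑ pp : Fin 3, ∑ j : Fin 3, conj (c k pp) * (a s j * (2 * Real.pi * Complex.I *
          (((k - s) j : ℤ) : ℂ)) * c (k - s) pp)) +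
        (2 * Real.pi * Complex.I) * ((∑ pp : Fin 3, conj (c (k - s) pp) * c k pp) *
          ∑ j : Fin 3, conj (a s j) * ((s j : ℤ) : ℂ)) := by
      rw [map_sum, ← Finset.sum_neg_distrib, Finset.sum_mul_sum, Finset.mul_sum, ← Finset.sum_add_distrib]
      refine Finset.sum_congr rfl fun pp _ => ?_
      rw [map_sum, ← Finset.sum_neg_distrib, Finset.mul_sum, ← Finset.sum_add_distrib]
      refine Finset.sum_congr rfl fun j _ => ?_
      rw [hreal j]
      simp only [map_mul, Complex.conj_conj, Complex.conj_ofReal, Complex.conj_I, map_ofNat, map_intCast,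
        Pi.sub_apply, Int.cast_sub, map_sub]
      ring
    rw [hS', ← add_assoc, htrans', mul_zero, mul_zero, add_zero, ← sub_eq_add_neg, Complex.sub_re,
      Complex.conj_re, sub_self]
  · -- non-fixed: `g q ≠ q` since `s ≠ 0`
    intro q hq _
    obtain ⟨k, s⟩ := q
    simp only [hE, Finset.mem_filter, Finset.mem_product] at hq
    obtain ⟨y, hy⟩ := Torus.mem_abcFreq.mp hq.1.2
    intro h
    have hs0 : -s = s := (Prod.mk.inj h).2
    have hs : s = 0 := by
      funext j
      have h1 : -s j = s j := by simpa using congrFun hs0 j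
      simp only [Pi.zero_apply]
      omega
    exact Torus.abcDir_ne_zero y (hy.trans hs)
  · -- `g` maps `E` to `E`
    intro q hq
    obtain ⟨k, s⟩ := q
    simp only [hE, Finset.mem_filter, Finset.mem_product] at hq ⊢
    obtain ⟨⟨hkF, hs⟩, hksF⟩ := hq
    refine ⟨⟨hksF, Torus.neg_mem_abcFreq s hs⟩, ?_⟩
    simpa using hkF
  · -- `g` is an involution
    intro q hq
    obtain ⟨k, s⟩ := q
    simp

/-! ## §3 The stretch symbol is the Jacobian of the ABC field; pointwise Lemma S -/

/-- The characters `e_{−e_m} = conj e_{e_m}` on the ABC shell. [folklore] -/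
theorem mFourier_abcDir_false (m : Fin 3) (x : UnitAddTorus (Fin 3)) :
    mFourier (Torus.abcDir (m, false)) x = conj (mFourier (Pi.single m 1) x) := by
  rw [← mFourier_neg]
  congr 1
  rw [← Pi.single_neg]
  simp [Torus.abcDir]

/-- The characters `e_{+e_m}` on the ABC shell. [folklore] -/
theorem mFourier_abcDir_true (m : Fin 3) (x : UnitAddTorus (Fin 3)) :
    mFourier (Torus.abcDir (m, true)) x = mFourier (Pi.single m 1) x := by
  simp [Torus.abcDir]

/-- **The Jacobian `∂_j U_p` of `U = Torus.abcFlow 1 1 1` as a lattice symbol, explicitly**: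
`Σ_{s∈{±e_m}} e_s(x) (2πi s_j) Û_p(s) = 2π D_{pj}(x)` with the real matrix
`D = [[0, −Im e₁, Re e₂], [Re e₀, 0, −Im e₂], [−Im e₀, Re e₁, 0]]`, `e_m = e^{2πi x_m}` — i.e.
`2π` times the Jacobian of `(sin z + cos y, sin x + cos z, sin y + cos x)` at `(x,y,z) = 2π·x`. -/
theorem jacobian_entry (x : UnitAddTorus (Fin 3)) (p j : Fin 3) :
    ∑ s ∈ Torus.abcFreq, mFourier s x * (2 * Real.pi * Complex.I * ((s j : ℤ) : ℂ)) * Torus.abcCoeff 1 1 1 s p =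
      ((2 * Real.pi * (![![(0 : ℝ), -(mFourier (Pi.single 1 1) x).im, (mFourier (Pi.single 2 1) x).re],
        ![(mFourier (Pi.single 0 1) x).re, 0, -(mFourier (Pi.single 2 1) x).im],
        ![-(mFourier (Pi.single 0 1) x).im, (mFourier (Pi.single 1 1) x).re, 0]] p j) : ℝ) : ℂ) := by
  rw [Torus.sum_abcFreq, Fintype.sum_prod_type]
  simp only [Fin.sum_univ_three, Fintype.sum_bool, mFourier_abcDir_false, mFourier_abcDir_true]
  fin_cases p <;> fin_cases j <;>
    simp [Torus.abcDir_apply, Torus.abcCoeff_apply, Torus.abcAmp,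
      show (0 : Fin 3) + 1 = 1 from rfl, show (0 : Fin 3) + 2 = 2 from rfl,
      show (1 : Fin 3) + 1 = 2 from rfl, show (1 : Fin 3) + 2 = 0 from rfl,
      show (2 : Fin 3) + 1 = 0 from rfl, show (2 : Fin 3) + 2 = 1 from rfl] <;>
    apply Complex.ext <;> simp <;> ring

/-- **Pointwise Lemma S for the complexified Jacobian form**: for every `v ∈ ℂ³` and every point,
`|Re Σ_p Σ_j conj(v_p) (2π D_{pj}(x)) v_j| ≤ 2π√2 ‖v‖²` (`D` as in `jacobian_entry`; real and
imaginary parts of `v` separately obey `SkewCutCertificate.strain_form_sq_le`). -/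
theorem abs_re_jacobianForm_le (x : UnitAddTorus (Fin 3)) (v : EuclideanSpace ℂ (Fin 3)) :
    |(∑ p : Fin 3, ∑ j : Fin 3, conj (v p) *
        (((2 * Real.pi * (![![(0 : ℝ), -(mFourier (Pi.single 1 1) x).im, (mFourier (Pi.single 2 1) x).re],
          ![(mFourier (Pi.single 0 1) x).re, 0, -(mFourier (Pi.single 2 1) x).im],
          ![-(mFourier (Pi.single 0 1) x).im, (mFourier (Pi.single 1 1) x).re, 0]] p j) : ℝ) : ℂ) * v j)).re| ≤
      2 * Real.pi * Real.sqrt 2 * ‖v‖ ^ 2 := by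
  -- unit characters
  have hunit : ∀ m : Fin 3, (mFourier (Pi.single m (1 : ℤ)) x).re ^ 2 + (mFourier (Pi.single m (1 : ℤ)) x).im ^ 2 = 1 := by
    intro m
    have h := norm_mFourier_apply (Pi.single m (1 : ℤ)) x
    have h2 : ‖mFourier (Pi.single m (1 : ℤ)) x‖ ^ 2 = 1 := by rw [h, one_pow]
    rw [Complex.sq_norm, Complex.normSq_apply] at h2
    nlinarith [h2]
  set r0 := (mFourier (Pi.single (0 : Fin 3) (1 : ℤ)) x).re with hr0
  set i0 := (mFourier (Pi.single (0 : Fin 3) (1 : ℤ)) x).im with hi0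
  set r1 := (mFourier (Pi.single (1 : Fin 3) (1 : ℤ)) x).re with hr1
  set i1 := (mFourier (Pi.single (1 : Fin 3) (1 : ℤ)) x).im with hi1
  set r2 := (mFourier (Pi.single (2 : Fin 3) (1 : ℤ)) x).re with hr2
  set i2 := (mFourier (Pi.single (2 : Fin 3) (1 : ℤ)) x).im with hi2
  have h0 := hunit 0; have h1 := hunit 1; have h2 := hunit 2
  rw [← hr0, ← hi0] at h0; rw [← hr1, ← hi1] at h1; rw [← hr2, ← hi2] at h2
  set α0 := (v 0).re; set α1 := (v 1).re; set α2 := (v 2).re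
  set β0 := (v 0).im; set β1 := (v 1).im; set β2 := (v 2).im
  -- the real part of the form
  have hform : (∑ p : Fin 3, ∑ j : Fin 3, conj (v p) *
        (((2 * Real.pi * (![![(0 : ℝ), -i1, r2], ![r0, 0, -i2], ![-i0, r1, 0]] p j) : ℝ) : ℂ) * v j)).re =
      2 * Real.pi * (2 * ((r0 - i1) / 2 * α0 * α1 + (r2 - i0) / 2 * α0 * α2 + (r1 - i2) / 2 * α1 * α2) +
        2 * ((r0 - i1) / 2 * β0 * β1 + (r2 - i0) / 2 * β0 * β2 + (r1 - i2) / 2 * β1 * β2)) := by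
    simp only [Fin.sum_univ_three, Complex.add_re, Complex.mul_re, Complex.mul_im, Complex.conj_re,
      Complex.conj_im, Complex.ofReal_re, Complex.ofReal_im, Matrix.cons_val_zero, Matrix.cons_val_one,
      Matrix.cons_val_two, Matrix.head_cons, Matrix.tail_cons]
    ring
  -- Lemma S for real and imaginary parts
  have habc : ((r0 - i1) / 2) ^ 2 + ((r2 - i0) / 2) ^ 2 + ((r1 - i2) / 2) ^ 2 ≤ 3 / 2 := by
    nlinarith [sq_nonneg (r0 + i1), sq_nonneg (r2 + i0), sq_nonneg (r1 + i2)]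
  have hα := SkewCutCertificate.strain_form_sq_le habc α0 α1 α2
  have hβ := SkewCutCertificate.strain_form_sq_le habc β0 β1 β2
  have hqα : 0 ≤ α0 ^ 2 + α1 ^ 2 + α2 ^ 2 := by positivity
  have hqβ : 0 ≤ β0 ^ 2 + β1 ^ 2 + β2 ^ 2 := by positivity
  have hsqrt : ∀ {P Q : ℝ}, 0 ≤ Q → P ^ 2 ≤ 2 * Q ^ 2 → |P| ≤ Real.sqrt 2 * Q := by
    intro P Q hQ hPQ
    calc |P| = Real.sqrt (P ^ 2) := (Real.sqrt_sq_eq_abs P).symm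
      _ ≤ Real.sqrt (2 * Q ^ 2) := Real.sqrt_le_sqrt hPQ
      _ = Real.sqrt 2 * Q := by rw [Real.sqrt_mul (by norm_num : (0:ℝ) ≤ 2), Real.sqrt_sq hQ]
  have hAα := hsqrt hqα hα
  have hAβ := hsqrt hqβ hβ
  -- the norm
  have hnorm : ‖v‖ ^ 2 = (α0 ^ 2 + α1 ^ 2 + α2 ^ 2) + (β0 ^ 2 + β1 ^ 2 + β2 ^ 2) := by
    rw [EuclideanSpace.norm_sq_eq]
    simp only [Fin.sum_univ_three, Complex.sq_norm, Complex.normSq_apply]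
    ring
  rw [hform, hnorm]
  have h2π : 0 ≤ 2 * Real.pi := by positivity
  calc |2 * Real.pi * (2 * ((r0 - i1) / 2 * α0 * α1 + (r2 - i0) / 2 * α0 * α2 + (r1 - i2) / 2 * α1 * α2) +
          2 * ((r0 - i1) / 2 * β0 * β1 + (r2 - i0) / 2 * β0 * β2 + (r1 - i2) / 2 * β1 * β2))|
        = 2 * Real.pi * |2 * ((r0 - i1) / 2 * α0 * α1 + (r2 - i0) / 2 * α0 * α2 + (r1 - i2) / 2 * α1 * α2) +
          2 * ((r0 - i1) / 2 * β0 * β1 + (r2 - i0) / 2 * β0 * β2 + (r1 - i2) / 2 * β1 * β2)| := by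
          rw [abs_mul, abs_of_nonneg h2π]
    _ ≤ 2 * Real.pi * (Real.sqrt 2 * (α0 ^ 2 + α1 ^ 2 + α2 ^ 2) + Real.sqrt 2 * (β0 ^ 2 + β1 ^ 2 + β2 ^ 2)) := by
          refine mul_le_mul_of_nonneg_left ((abs_add_le _ _).trans (add_le_add hAα hAβ)) h2π
    _ = 2 * Real.pi * Real.sqrt 2 * ((α0 ^ 2 + α1 ^ 2 + α2 ^ 2) + (β0 ^ 2 + β1 ^ 2 + β2 ^ 2)) := by ring

/-- **Pointwise Lemma S, symbol form**: for every `v ∈ ℂ³` and every point `x` of the torus,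
`|Re Σ_p Σ_j conj(v_p) (Σ_{s∈{±e_m}} e_s(x) (2πi s_j) Û_p(s)) v_j| ≤ 2π√2 ‖v‖²`
(`jacobian_entry` + `abs_re_jacobianForm_le`). -/
theorem abs_re_jacobianForm_le' (x : UnitAddTorus (Fin 3)) (v : EuclideanSpace ℂ (Fin 3)) :
    |(∑ p : Fin 3, ∑ j : Fin 3, conj (v p) *
        ((∑ s ∈ Torus.abcFreq, mFourier s x * (2 * Real.pi * Complex.I * ((s j : ℤ) : ℂ)) *
            Torus.abcCoeff 1 1 1 s p) * v j)).re| ≤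
      2 * Real.pi * Real.sqrt 2 * ‖v‖ ^ 2 := by
  simp_rw [jacobian_entry]
  exact abs_re_jacobianForm_le x v

end Summit.NavierStokesRegularity.FluidComputer.AbcLatticePairingSplit

end
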